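/-
Origin: expansion seat `prover-pub-hodgecm-mc-binder-2-g11-0`, handover #44 2026-08-20T03:45Z md5 4cc05162d3fd (139 l.; CERTIFIED rc 0 / 0 warn / 40.9 s; imports #36 `OmgInsIota` only; (J-x₀) step (d) part ι₁: §1 `linSubst_star_dualPairι_X_QS_general` / `_X_QR_general` (the `V⁻`-rows of dictionary #15); §2 R-reading `linSubst_star_dualPairι_kV_rename_z` (`z_aj ↦ Σ_b A_(eA b, eA a) z_bj`), `_kV_rename_w` (`w_j ↦ conj(D_q₀q₀) w_j`, `[Subsingleton Q']`), **`linSubst_star_dualPairι_kV_rename_detZ`** (`det z ↦ det(A read through eA) • det z` under the V-letter `((A,D),(1,1))`); §3 S-reading twins `…_kV_S_rename_z/_w/_detZ` (eigenvalue `det(conj A …)`); pure algebra over `Matrix.det_fin_two`; NAME LIST `HodgeCM.Model.HypCensus.linSubst_star_dualPairι_kV_rename_detZ`, `HodgeCM.Model.HypCensus.linSubst_star_dualPairι_kV_S_rename_detZ`, `HodgeCM.Model.HypCensus.linSubst_star_dualPairι_X_QR_general`; axioms: no new) (`HOME/mc/pub-hodgecm-mc-binder-2/g11/pkg/HodgeCM/Model/HypCensus/VLetterIota.lean`,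 md5 4cc05162d3fd, 150 lines);
landed by the second packager p2 gen 2 (p2-g2) in gate run 40 as `HodgeCM/Model/HypCensus/VLetterIota.lean` (verbatim).
-/
/-
Origin: speedrun cell pub-hodgecm, MODEL-CONSTRUCTION sub-cell, lineage mc-binder-2 (BINDER-OWNERS rows 18/19: E binders
`hyp12` / `hyp34` of `Model.perL_picardCM_r15A`), seat prover-pub-hodgecm-mc-binder-2-g11-0 (gen 11), 2026-08-20.
Target in PKG: `HodgeCM/Model/HypCensus/VLetterIota.lean` (NEW additive leaf; imports this lineage's `HypCensus/OmgInsIota` (#36)).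
KERNEL ONLY: 0 records, nothing cited as hypothesis, 0 `def … : Prop`; theorems only.
-/
import Summits.HodgeConjecture.HodgeCM.Model.HypCensus.OmgInsIota

/-!
# Census kit (rows A12/A34), (J-x₀) step (d), part ι₁: the printed line `det z` under the `V`-LETTERS `((A, D), (1, 1))`

The (J-x₀) twin of #16/#36 (which treat the `W`-torus letters `((1,1),(c,c'))`): under a `K_V`-letter `((A, D), (1, 1))`
(`A ∈ U(V⁺_{ι₁})`, `D ∈ U(V⁻_{ι₁})`, `V⁻` one-dimensional) the inserted printed line `det z` is an eigenvector, with eigenvalue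
`det(A read through eA)` in the positive `W`-reading and its conjugate in the negative one — pv12-g4's `rowSubst_detZ`
(`PerL34/FockGroupInvariants`) read in Konno–Konno's block coordinates.

* §1 `linSubst_star_dualPairι_X_QS_general` / `_X_QR_general` — the two `V⁻`-rows of the dictionary #15 left out;
* §2 (R-reading, `planeToDPIdx`) `linSubst_star_dualPairι_kV_rename_z/_w/_detZ`;
* §3 (S-reading, `planeToDPIdxS`) the twins `…_kV_S_rename_z/_w/_detZ`.

Nothing here is a claim of PerL/QW8.
-/

set_option autoImplicit false

noncomputable section

open MvPolynomial Complex
open scoped BigOperators ComplexConjugate Kronecker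
open Literature.Analysis.SegalBargmann
open Literature.RepresentationTheory.KonnoKonno2007 Literature.RepresentationTheory.KonnoKonno2007.RealDualPair
open HodgeCM.PerL34.Fock HodgeCM.PerL34.Fock.PrintDict

namespace HodgeCM.Model.HypCensus

section General

variable {P' Q' R' S' : Type} [Fintype P'] [DecidableEq P'] [Fintype Q'] [DecidableEq Q'] [Fintype R'] [DecidableEq R']
  [Fintype S'] [DecidableEq S']

/-- same-sign block, `V⁻`-rows: `X_{(q,s)} ↦ Σ_{q',s'} b_{q'q} d_{s's} X_{(q',s')}`. [folklore] -/
theorem linSubst_star_dualPairι_X_QS_general (k : DPK P' Q' R' S') (q : Q') (s : S') :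
    linSubst (star ((dualPairι k : Matrix.unitaryGroup (DPIdx P' Q' R' S') ℂ) :
        Matrix (DPIdx P' Q' R' S') (DPIdx P' Q' R' S') ℂ)) (X (Sum.inl (Sum.inr (q, s)))) =
      ∑ q' : Q', ∑ s' : S', C ((k.1.2 : Matrix Q' Q' ℂ) q' q * (k.2.2 : Matrix S' S' ℂ) s' s) * X (Sum.inl (Sum.inr (q', s'))) := by
  rw [linSubst_X, coe_dualPairι]
  simp only [Fintype.sum_sum_type, Fintype.sum_prod_type, Matrix.star_apply, Matrix.fromBlocks_apply₁₁, Matrix.fromBlocks_apply₁₂,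
    Matrix.fromBlocks_apply₂₁, Matrix.fromBlocks_apply₂₂, Matrix.map_apply, Matrix.kroneckerMap_apply, star_mul', star_star,
    Matrix.zero_apply, star_zero, map_zero, zero_mul, Finset.sum_const_zero, add_zero, zero_add]

/-- mixed block, `V⁻`-rows: `X_{(q,r)} ↦ Σ_{q',r'} conj(b_{q'q}) conj(c_{r'r}) X_{(q',r')}`. [folklore] -/
theorem linSubst_star_dualPairι_X_QR_general (k : DPK P' Q' R' S') (q : Q') (r : R') :
    linSubst (star ((dualPairι k : Matrix.unitaryGroup (DPIdx P' Q' R' S') ℂ) :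
        Matrix (DPIdx P' Q' R' S') (DPIdx P' Q' R' S') ℂ)) (X (Sum.inr (Sum.inr (q, r)))) =
      ∑ q' : Q', ∑ r' : R', C (star ((k.1.2 : Matrix Q' Q' ℂ) q' q) * star ((k.2.1 : Matrix R' R' ℂ) r' r)) *
        X (Sum.inr (Sum.inr (q', r'))) := by
  rw [linSubst_X, coe_dualPairι]
  simp only [Fintype.sum_sum_type, Fintype.sum_prod_type, Matrix.star_apply, Matrix.fromBlocks_apply₁₂,
    Matrix.fromBlocks_apply₂₂, Matrix.kroneckerMap_apply, star_mul',
    Matrix.zero_apply, star_zero, map_zero, zero_mul, Finset.sum_const_zero, zero_add]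

end General

/-! ## §2 The positive `W`-reading -/

section PosReading

variable {P' Q' R' S' : Type} [Fintype P'] [DecidableEq P'] [Fintype Q'] [DecidableEq Q'] [Fintype R'] [DecidableEq R']
  [Fintype S'] [DecidableEq S']
variable (eA : Fin 2 ≃ P') (eR : Fin 2 ≃ R') (q₀ : Q')

/-- `z_{aj} ↦ Σ_b A_{eA b, eA a} z_{bj}` under the `V`-letter `((A,D),(1,1))`. [folklore] -/
theorem linSubst_star_dualPairι_kV_rename_z (A : Matrix.unitaryGroup P' ℂ) (D : Matrix.unitaryGroup Q' ℂ) (a j : Fin 2) :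
    linSubst (star ((dualPairι (((A, D), (1, 1)) : DPK P' Q' R' S') : Matrix.unitaryGroup (DPIdx P' Q' R' S') ℂ) :
        Matrix (DPIdx P' Q' R' S') (DPIdx P' Q' R' S') ℂ)) (rename (planeToDPIdx eA eR q₀ S') (HodgeCM.PerL34.Fock.z a j)) =
      ∑ b : Fin 2, C ((A : Matrix P' P' ℂ) (eA b) (eA a)) * rename (planeToDPIdx eA eR q₀ S') (HodgeCM.PerL34.Fock.z b j) := by
  simp only [HodgeCM.PerL34.Fock.z, rename_X, planeToDPIdx_z]
  rw [linSubst_star_dualPairι_X_PR_general]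
  simp only [OneMemClass.coe_one, Matrix.one_apply, mul_ite, mul_one, mul_zero, apply_ite C, map_zero, ite_mul, zero_mul,
    Finset.sum_ite_eq', Finset.mem_univ, if_true]
  exact (eA.sum_comp fun p' => C ((A : Matrix P' P' ℂ) p' (eA a)) * X (Sum.inl (Sum.inl (p', eR j)))).symm

/-- `w_j ↦ conj(D_{q₀q₀}) w_j` (one-dimensional `V⁻`). [folklore] -/
theorem linSubst_star_dualPairι_kV_rename_w [Subsingleton Q'] (A : Matrix.unitaryGroup P' ℂ) (D : Matrix.unitaryGroup Q' ℂ) (j : Fin 2) :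
    linSubst (star ((dualPairι (((A, D), (1, 1)) : DPK P' Q' R' S') : Matrix.unitaryGroup (DPIdx P' Q' R' S') ℂ) :
        Matrix (DPIdx P' Q' R' S') (DPIdx P' Q' R' S') ℂ)) (rename (planeToDPIdx eA eR q₀ S') (HodgeCM.PerL34.Fock.w j)) =
      C (star ((D : Matrix Q' Q' ℂ) q₀ q₀)) * rename (planeToDPIdx eA eR q₀ S') (HodgeCM.PerL34.Fock.w j) := by
  have hw : planeToDPIdx eA eR q₀ S' (Sum.inr j) = Sum.inr (Sum.inr (q₀, eR j)) := rfl
  simp only [HodgeCM.PerL34.Fock.w, rename_X, hw]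
  rw [linSubst_star_dualPairι_X_QR_general, Fintype.sum_subsingleton _ q₀]
  simp only [OneMemClass.coe_one, Matrix.one_apply, apply_ite star, star_one, star_zero, mul_ite, mul_one, mul_zero, apply_ite C,
    map_zero, ite_mul, zero_mul, Finset.sum_ite_eq', Finset.mem_univ, if_true]

/-- **the printed line transforms by `det A`** under the `V`-letter `((A,D),(1,1))` (positive `W`-reading). [folklore] -/
theorem linSubst_star_dualPairι_kV_rename_detZ (A : Matrix.unitaryGroup P' ℂ) (D : Matrix.unitaryGroup Q' ℂ) :
    linSubst (star ((dualPairι (((A, D), (1, 1)) : DPK P' Q' R' S') : Matrix.unitaryGroup (DPIdx P' Q' R' S') ℂ) :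
        Matrix (DPIdx P' Q' R' S') (DPIdx P' Q' R' S') ℂ)) (rename (planeToDPIdx eA eR q₀ S') HodgeCM.PerL34.Fock.detZ) =
      (Matrix.of fun a b : Fin 2 => (A : Matrix P' P' ℂ) (eA b) (eA a)).det • rename (planeToDPIdx eA eR q₀ S') HodgeCM.PerL34.Fock.detZ := by
  simp only [HodgeCM.PerL34.Fock.detZ, map_sub, map_mul, linSubst_star_dualPairι_kV_rename_z, Fin.sum_univ_two, Matrix.det_fin_two,
    Matrix.of_apply, smul_eq_C_mul, map_sub, map_mul]
  ring

end PosReading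

/-! ## §3 The negative `W`-reading -/

section NegReading

variable {P' Q' R' S' : Type} [Fintype P'] [DecidableEq P'] [Fintype Q'] [DecidableEq Q'] [Fintype R'] [DecidableEq R']
  [Fintype S'] [DecidableEq S']
variable (eA : Fin 2 ≃ P') (eS : Fin 2 ≃ S') (q₀ : Q')

/-- `z_{aj} ↦ Σ_b conj(A_{eA b, eA a}) z_{bj}` (mixed block). [folklore] -/
theorem linSubst_star_dualPairι_kV_S_rename_z (A : Matrix.unitaryGroup P' ℂ) (D : Matrix.unitaryGroup Q' ℂ) (a j : Fin 2) :
    linSubst (star ((dualPairι (((A, D), (1, 1)) : DPK P' Q' R' S') : Matrix.unitaryGroup (DPIdx P' Q' R' S') ℂ) :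
        Matrix (DPIdx P' Q' R' S') (DPIdx P' Q' R' S') ℂ)) (rename (planeToDPIdxS eA eS q₀ R') (HodgeCM.PerL34.Fock.z a j)) =
      ∑ b : Fin 2, C (star ((A : Matrix P' P' ℂ) (eA b) (eA a))) * rename (planeToDPIdxS eA eS q₀ R') (HodgeCM.PerL34.Fock.z b j) := by
  simp only [HodgeCM.PerL34.Fock.z, rename_X, planeToDPIdxS_z]
  rw [linSubst_star_dualPairι_X_PS_general]
  simp only [OneMemClass.coe_one, Matrix.one_apply, apply_ite star, star_one, star_zero, mul_ite, mul_one, mul_zero, apply_ite C,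
    map_zero, ite_mul, zero_mul, Finset.sum_ite_eq', Finset.mem_univ, if_true]
  exact (eA.sum_comp fun p' => C (star ((A : Matrix P' P' ℂ) p' (eA a))) * X (Sum.inr (Sum.inl (p', eS j)))).symm

/-- `w_j ↦ D_{q₀q₀} w_j` (same-sign block, one-dimensional `V⁻`). [folklore] -/
theorem linSubst_star_dualPairι_kV_S_rename_w [Subsingleton Q'] (A : Matrix.unitaryGroup P' ℂ) (D : Matrix.unitaryGroup Q' ℂ)
    (j : Fin 2) :
    linSubst (star ((dualPairι (((A, D), (1, 1)) : DPK P' Q' R' S') : Matrix.unitaryGroup (DPIdx P' Q' R' S') ℂ) :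
        Matrix (DPIdx P' Q' R' S') (DPIdx P' Q' R' S') ℂ)) (rename (planeToDPIdxS eA eS q₀ R') (HodgeCM.PerL34.Fock.w j)) =
      C ((D : Matrix Q' Q' ℂ) q₀ q₀) * rename (planeToDPIdxS eA eS q₀ R') (HodgeCM.PerL34.Fock.w j) := by
  have hw : planeToDPIdxS eA eS q₀ R' (Sum.inr j) = Sum.inl (Sum.inr (q₀, eS j)) := rfl
  simp only [HodgeCM.PerL34.Fock.w, rename_X, hw]
  rw [linSubst_star_dualPairι_X_QS_general, Fintype.sum_subsingleton _ q₀]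
  simp only [OneMemClass.coe_one, Matrix.one_apply, mul_ite, mul_one, mul_zero, apply_ite C, map_zero, ite_mul, zero_mul,
    Finset.sum_ite_eq', Finset.mem_univ, if_true]

/-- **the printed line transforms by `conj(det A)`** under the `V`-letter `((A,D),(1,1))` (negative `W`-reading). [folklore] -/
theorem linSubst_star_dualPairι_kV_S_rename_detZ (A : Matrix.unitaryGroup P' ℂ) (D : Matrix.unitaryGroup Q' ℂ) :
    linSubst (star ((dualPairι (((A, D), (1, 1)) : DPK P' Q' R' S') : Matrix.unitaryGroup (DPIdx P' Q' R' S') ℂ) :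
        Matrix (DPIdx P' Q' R' S') (DPIdx P' Q' R' S') ℂ)) (rename (planeToDPIdxS eA eS q₀ R') HodgeCM.PerL34.Fock.detZ) =
      (Matrix.of fun a b : Fin 2 => star ((A : Matrix P' P' ℂ) (eA b) (eA a))).det •
        rename (planeToDPIdxS eA eS q₀ R') HodgeCM.PerL34.Fock.detZ := by
  simp only [HodgeCM.PerL34.Fock.detZ, map_sub, map_mul, linSubst_star_dualPairι_kV_S_rename_z, Fin.sum_univ_two, Matrix.det_fin_two,
    Matrix.of_apply, smul_eq_C_mul, map_sub, map_mul]
  ring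

end NegReading

end HodgeCM.Model.HypCensus

end
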